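import Mathlib
import Summits.AnomalousDissipation.AnomalousDissipation.Theses.DyadicWallCascade
import Summits.AnomalousDissipation.AnomalousDissipation.Theses.CoherentStates
import Summits.AnomalousDissipation.AnomalousDissipation.Theorems.DyadicWallCascadeDyadicRealisationGateReduction
import Summits.AnomalousDissipation.AnomalousDissipation.Theorems.DyadicWallCascadeDyadicRealisationLerayCapping
import Summits.AnomalousDissipation.AnomalousDissipation.Theorems.DyadicWallCascadeDyadicRealisationProfileNormalisations
import HarnessLib

/-!
# Crux `DyadicWallCascade.DyadicRealisation` (stmt-AnomalousDissipation-17918), line `Sketch`: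
# the logical kernel left by the line

Line `Sketch` (card leray-capped-standing-cascade) has landed `stub_gateReduction` (p146963),
`stub_fluxSign` (p152335), `stub_zeroStress` (p154515), `stub_lerayCapping` (p158513), the reduction
`stub_cruxOfTestedRealisation` (p159013) and `stub_profileNormalisations` (p159127); its one open stub is
the transferred crux `C⁺` (`stub_testedRealisation`: loud bounded steady `NS_ν(f)` states for every capped
pair of every normalised half-space hierarchy).  This file records, sorry-free and BY NAME of the route
decls, where that leaves the crux — the facts a planner needs to decide between promoting `C⁺` and
re-lining:

* `dyadicRealisation_of_steadyZerothLaw` — the crux is implied by its own consequent, the shared steady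
  zeroth law `CoherentStates.SteadyZerothLaw` (stmt-0219) (`rfl`-level; the positive edge).
* `dyadicRealisation_of_not_normalisedHierarchy` — the crux HOLDS unless a NORMALISED half-space
  hierarchy exists (the clause block of crux #2 `HalfSpaceHierarchy` together with `F < 0` and zero
  Reynolds stress `τ₀ = τ₁ = 0` through the unit square of `z = 1`): by `stub_profileNormalisations`
  every viscous wall profile blows down to one.  In particular `¬HalfSpaceHierarchy` proves the crux.
* `steadyZerothLaw_of_testedRealisation` — `C⁺` implies the WEAKER kernel
  `K₀ := (normalised hierarchy exists) → SteadyZerothLaw` (via `stub_lerayCapping` + `stub_gateReduction`),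
  and `dyadicRealisation_of_normalisedKernel` — `K₀` already implies the crux.  So `K₀`, not `C⁺`, is the
  weakest statement through which this line closes the crux; `C⁺` strengthens it only by naming the force
  (`f = P r`, the Leray-capped hierarchy) for which loud states are to be found.
* `dyadicRealisation_iff_of_viscousContinuation` — modulo crux #3 `ViscousContinuation` (which the route's
  assembly needs anyway) the crux is EQUIVALENT to `HalfSpaceHierarchy → SteadyZerothLaw`, and
  (`dyadicRealisation_iff_normalisedKernel_of_viscousContinuation`) to `K₀`: as typed, the viscous profile
  `W` enters crux #4 only through the existence of its normalised blow-down.  A line that wants to USE `W`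
  (inner approximants `u_m ≈ W(x/ν_m)`, resolvent of the linearisation at `W`) needs quantitative
  information the antecedent `ViscousWallProfile` does not carry (rates / non-degeneracy of the blow-down).

No new definitions: the normalised-hierarchy block is written out (verbatim the conclusion of
`stub_profileNormalisations`), `C⁺` verbatim the registered stub signature.
-/

noncomputable section

open MeasureTheory Filter Set
open scoped InnerProductSpace Topology BigOperators

-- the mandated namespace `Summit.<Summit>.<Problem>.Theorems` repeats `AnomalousDissipation`
set_option linter.dupNamespace false

namespace Summit.AnomalousDissipation.AnomalousDissipation.Theorems

/-- **Positive edge.** The crux `DyadicRealisation` (`= ViscousWallProfile → SteadyZerothLaw` by `rfl`)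
follows from the shared steady zeroth law `CoherentStates.SteadyZerothLaw` (stmt-0219) alone; the term
`fun h _ => h` elaborates only because the crux's consequent is that decl's body verbatim. [folklore] -/
theorem dyadicRealisation_of_steadyZerothLaw
    (h : Summit.AnomalousDissipation.AnomalousDissipation.Theses.CoherentStates.SteadyZerothLaw) :
    Summit.AnomalousDissipation.AnomalousDissipation.Theses.DyadicWallCascade.DyadicRealisation :=
  fun _ => h

/-- **The crux holds unless a normalised hierarchy exists.**  If there is NO half-space hierarchy
`(V, Q, C, F)` (clause block of crux #2, let-free) with `F < 0` and zero Reynolds stress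
`∫_{[0,1]²} V₂V₀(q,1) dq = ∫_{[0,1]²} V₂V₁(q,1) dq = 0`, then `DyadicRealisation` holds — vacuously, because
every viscous wall profile blows down to such a hierarchy (`stub_profileNormalisations`: `stub_fluxSign` +
`stub_zeroStress`).  In particular any refutation of crux #2 `HalfSpaceHierarchy` proves crux #4. [folklore] -/
theorem dyadicRealisation_of_not_normalisedHierarchy
    (hN : ¬ ∃ (V : EuclideanSpace ℝ (Fin 3) → EuclideanSpace ℝ (Fin 3)) (Q : EuclideanSpace ℝ (Fin 3) → ℝ) (C F : ℝ), (ContDiffOn ℝ ((⊤ : ℕ∞) : WithTop ℕ∞) V {X : EuclideanSpace ℝ (Fin 3) | 0 < X 2} ∧ ContDiffOn ℝ ((⊤ : ℕ∞) : WithTop ℕ∞) Q {X : EuclideanSpace ℝ (Fin 3) | 0 < X 2} ∧ (∀ X : EuclideanSpace ℝ (Fin 3), 0 < X 2 → ‖V X‖ ≤ C ∧ |Q X| ≤ C) ∧ (∀ X : EuclideanSpace ℝ (Fin 3), 0 < X 2 → ∑ i : Fin 3, (fderiv ℝ V X (EuclideanSpace.single i (1 : ℝ))) i = 0) ∧ (∀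 X : EuclideanSpace ℝ (Fin 3), 0 < X 2 → (fderiv ℝ V X) (V X) + gradient Q X = 0) ∧ (∀ X : EuclideanSpace ℝ (Fin 3), 0 < X 2 → V ((2 : ℝ) • X) = V X ∧ Q ((2 : ℝ) • X) = Q X) ∧ (∀ X : EuclideanSpace ℝ (Fin 3), 1 ≤ X 2 → X 2 ≤ 2 → V (X + EuclideanSpace.single 0 (1 : ℝ)) = V X ∧ V (X + EuclideanSpace.single 1 (1 : ℝ)) = V X ∧ Q (X + EuclideanSpace.single 0 (1 : ℝ)) = Q X ∧ Q (X + EuclideanSpace.single 1 (1 : ℝ)) = Q X) ∧ (∫ q in Set.Icc (0 : ℝ) 1 ×ˢ Set.Icc (0 : ℝ) 1, (V !₂[q.1, q.2, (1 : ℝ)]) 2 = 0) ∧ F ≠ 0 ∧ (∫ q in Set.Icc (0 : ℝ) 1 ×ˢ Set.Icc (0 : ℝ) 1, (V !₂[q.1, q.2, (1 : ℝ)]) 2 * (‖V !₂[q.1, q.2, (1 : ℝ)]‖ ^ 2 / 2 + Q !₂[q.1, q.2, (1 : ℝ)]) = F)) ∧ F < 0 ∧ (∫ q in Set.Icc (0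 : ℝ) 1 ×ˢ Set.Icc (0 : ℝ) 1, (V !₂[q.1, q.2, (1 : ℝ)]) 2 * (V !₂[q.1, q.2, (1 : ℝ)]) 0 = 0) ∧ (∫ q in Set.Icc (0 : ℝ) 1 ×ˢ Set.Icc (0 : ℝ) 1, (V !₂[q.1, q.2, (1 : ℝ)]) 2 * (V !₂[q.1, q.2, (1 : ℝ)]) 1 = 0)) :
    Summit.AnomalousDissipation.AnomalousDissipation.Theses.DyadicWallCascade.DyadicRealisation :=
  fun hA => absurd (stub_profileNormalisations hA) hN

/-- **`¬HalfSpaceHierarchy` proves the crux** (special case of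
`dyadicRealisation_of_not_normalisedHierarchy`: a normalised hierarchy is in particular a hierarchy).
[folklore] -/
theorem dyadicRealisation_of_not_halfSpaceHierarchy
    (h2 : ¬ Summit.AnomalousDissipation.AnomalousDissipation.Theses.DyadicWallCascade.HalfSpaceHierarchy) :
    Summit.AnomalousDissipation.AnomalousDissipation.Theses.DyadicWallCascade.DyadicRealisation := by
  refine dyadicRealisation_of_not_normalisedHierarchy ?_
  rintro ⟨V, Q, C, F, hV, -, -, -⟩
  exact h2 ⟨V, Q, C, F, hV⟩

/-- **`C⁺` implies the weaker kernel `K₀`.**  The registered frontier stub `C⁺` (`stub_testedRealisation`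
of line `Sketch`, verbatim, taken here as a hypothesis) yields the steady zeroth law from the mere
EXISTENCE of a normalised half-space hierarchy: cap it (`stub_lerayCapping`, collar height `1/8`), take the
loud tested states `C⁺` provides for the capped pair, and read off the dissipation floor
(`stub_gateReduction`).  The viscous profile `W` is not mentioned. [folklore] -/
theorem steadyZerothLaw_of_testedRealisation
    (hC : ∀ (V : EuclideanSpace ℝ (Fin 3) → EuclideanSpace ℝ (Fin 3)) (Q : EuclideanSpace ℝ (Fin 3) → ℝ) (C F : ℝ), ContDiffOn ℝ ((⊤ : ℕ∞) : WithTop ℕ∞) V {X : EuclideanSpace ℝ (Fin 3) | 0 < X 2} ∧ ContDiffOn ℝ ((⊤ : ℕ∞) : WithTop ℕ∞) Q {X : EuclideanSpace ℝ (Fin 3) | 0 < X 2} ∧ (∀ X : EuclideanSpace ℝ (Fin 3), 0 < X 2 → ‖V X‖ ≤ C ∧ |Q X| ≤ C) ∧ (∀ X : EuclideanSpace ℝ (Fin 3), 0 < X 2 → ∑ i : Fin 3, (fderiv ℝ V X (EuclideanSpace.single i (1 : ℝ))) i = 0) ∧ (∀ X : EuclideanSpace ℝ (Fin 3), 0 <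 X 2 → (fderiv ℝ V X) (V X) + gradient Q X = 0) ∧ (∀ X : EuclideanSpace ℝ (Fin 3), 0 < X 2 → V ((2 : ℝ) • X) = V X ∧ Q ((2 : ℝ) • X) = Q X) ∧ (∀ X : EuclideanSpace ℝ (Fin 3), 1 ≤ X 2 → X 2 ≤ 2 → V (X + EuclideanSpace.single 0 (1 : ℝ)) = V X ∧ V (X + EuclideanSpace.single 1 (1 : ℝ)) = V X ∧ Q (X + EuclideanSpace.single 0 (1 : ℝ)) = Q X ∧ Q (X + EuclideanSpace.single 1 (1 : ℝ)) = Q X) ∧ (∫ q in Set.Icc (0 : ℝ) 1 ×ˢ Set.Icc (0 : ℝ) 1, (V !₂[q.1, q.2, (1 : ℝ)]) 2 = 0) ∧ F ≠ 0 ∧ (∫ q in Set.Icc (0 : ℝ) 1 ×ˢ Set.Icc (0 : ℝ) 1, (V !₂[q.1, q.2, (1 : ℝ)]) 2 * (‖V !₂[q.1, q.2, (1 : ℝ)]‖ ^ 2 / 2 + Q !₂[q.1, q.2, (1 : ℝ)]) = F) → F < 0 → (∫ q in Set.Icc (0 : ℝ) 1 ×ˢ Set.Icc (0 : ℝ) 1,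 (V !₂[q.1, q.2, (1 : ℝ)]) 2 * (V !₂[q.1, q.2, (1 : ℝ)]) 0 = 0) → (∫ q in Set.Icc (0 : ℝ) 1 ×ˢ Set.Icc (0 : ℝ) 1, (V !₂[q.1, q.2, (1 : ℝ)]) 2 * (V !₂[q.1, q.2, (1 : ℝ)]) 1 = 0) → ∀ (f r ub : UnitAddTorus (Fin 3) → EuclideanSpace ℝ (Fin 3)) (π : EuclideanSpace ℝ (Fin 3) → ℝ) (C' : ℝ), Literature.Analysis.FunctionSpaces.Torus.IsSmooth f ∧ Literature.Analysis.FunctionSpaces.Torus.IsDivFree f ∧ Literature.Analysis.FunctionSpaces.Torus.HasZeroMean f ∧ Literature.Analysis.FunctionSpaces.Torus.IsSmooth r ∧ (∀ Y : EuclideanSpace ℝ (Fin 3), |Y 2| < 1 / 16 → Literature.Analysis.FunctionSpaces.Torus.lift r Y = 0) ∧ (∀ w : UnitAddTorus (Fin 3) → EuclideanSpace ℝ (Fin 3), Literature.Analysis.FunctionSpaces.Torus.IsSmooth w → Literature.Analysis.FunctionSpaces.Torus.IsDivFree w → ∫ x, ⟪f x, w x⟫_ℝ = ∫ x, ⟪r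 x, w x⟫_ℝ) ∧ (∀ x, ‖ub x‖ ≤ C') ∧ (∀ Y : EuclideanSpace ℝ (Fin 3), 0 < Y 2 → Y 2 < 1 / 16 → Literature.Analysis.FunctionSpaces.Torus.lift ub Y = V Y) ∧ (∀ Y : EuclideanSpace ℝ (Fin 3), -(1 / 16) < Y 2 → Y 2 < 0 → Literature.Analysis.FunctionSpaces.Torus.lift ub Y = V (Y - (2 * Y 2) • EuclideanSpace.single 2 (1 : ℝ)) - (2 * (V (Y - (2 * Y 2) • EuclideanSpace.single 2 (1 : ℝ))) 2) • EuclideanSpace.single 2 (1 : ℝ)) ∧ ContDiffOn ℝ ((⊤ : ℕ∞) : WithTop ℕ∞) (Literature.Analysis.FunctionSpaces.Torus.lift ub) {Y : EuclideanSpace ℝ (Fin 3) | 0 < Y 2 ∧ Y 2 < 1} ∧ ContDiffOn ℝ ((⊤ : ℕ∞) : WithTop ℕ∞) π {Y : EuclideanSpace ℝ (Fin 3) | 0 < Y 2 ∧ Y 2 < 1} ∧ (∀ Y : EuclideanSpace ℝ (Fin 3), 0 < Y 2 → Y 2 < 1 → ∑ i : Fin 3, (fderiv ℝ (Literature.Analysis.FunctionSpaces.Torus.lift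 ub) Y (EuclideanSpace.single i (1 : ℝ))) i = 0) ∧ (∀ Y : EuclideanSpace ℝ (Fin 3), 0 < Y 2 → Y 2 < 1 → (fderiv ℝ (Literature.Analysis.FunctionSpaces.Torus.lift ub) Y) (Literature.Analysis.FunctionSpaces.Torus.lift ub Y) + gradient π Y = Literature.Analysis.FunctionSpaces.Torus.lift f Y) ∧ ∫ x, ⟪r x, ub x⟫_ℝ = -2 * F → ∃ (ν : ℕ → ℝ) (u : ℕ → UnitAddTorus (Fin 3) → EuclideanSpace ℝ (Fin 3)) (p : ℕ → UnitAddTorus (Fin 3) → ℝ), (∀ j, 0 < ν j) ∧ Filter.Tendsto ν Filter.atTop (nhds 0) ∧ (∀ j, Literature.Analysis.FunctionSpaces.Torus.IsClassicalNSSolutionOn Set.univ (ν j) (fun _ => f) (fun _ => u j) (fun _ => p j)) ∧ (∃ E : ℝ, ∀ j, ∫ x, ‖u j x‖ ^ 2 ≤ E) ∧ ∃ ε : ℝ, 0 < ε ∧ ∀ j, ε ≤ ∫ x, ⟪r x, u j x⟫_ℝ)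
    (hN : ∃ (V : EuclideanSpace ℝ (Fin 3) → EuclideanSpace ℝ (Fin 3)) (Q : EuclideanSpace ℝ (Fin 3) → ℝ) (C F : ℝ), (ContDiffOn ℝ ((⊤ : ℕ∞) : WithTop ℕ∞) V {X : EuclideanSpace ℝ (Fin 3) | 0 < X 2} ∧ ContDiffOn ℝ ((⊤ : ℕ∞) : WithTop ℕ∞) Q {X : EuclideanSpace ℝ (Fin 3) | 0 < X 2} ∧ (∀ X : EuclideanSpace ℝ (Fin 3), 0 < X 2 → ‖V X‖ ≤ C ∧ |Q X| ≤ C) ∧ (∀ X : EuclideanSpace ℝ (Fin 3), 0 < X 2 → ∑ i : Fin 3, (fderiv ℝ V X (EuclideanSpace.single i (1 : ℝ))) i = 0) ∧ (∀ X : EuclideanSpace ℝ (Fin 3), 0 < X 2 → (fderiv ℝ V X) (V X) + gradient Q X = 0) ∧ (∀ X : EuclideanSpace ℝ (Fin 3), 0 < X 2 → V ((2 : ℝ) • X) = V X ∧ Q ((2 : ℝ) • X) = Q X) ∧ (∀ X : EuclideanSpace ℝ (Fin 3), 1 ≤ X 2 → X 2 ≤ 2 → V (X + EuclideanSpace.single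 0 (1 : ℝ)) = V X ∧ V (X + EuclideanSpace.single 1 (1 : ℝ)) = V X ∧ Q (X + EuclideanSpace.single 0 (1 : ℝ)) = Q X ∧ Q (X + EuclideanSpace.single 1 (1 : ℝ)) = Q X) ∧ (∫ q in Set.Icc (0 : ℝ) 1 ×ˢ Set.Icc (0 : ℝ) 1, (V !₂[q.1, q.2, (1 : ℝ)]) 2 = 0) ∧ F ≠ 0 ∧ (∫ q in Set.Icc (0 : ℝ) 1 ×ˢ Set.Icc (0 : ℝ) 1, (V !₂[q.1, q.2, (1 : ℝ)]) 2 * (‖V !₂[q.1, q.2, (1 : ℝ)]‖ ^ 2 / 2 + Q !₂[q.1, q.2, (1 : ℝ)]) = F)) ∧ F < 0 ∧ (∫ q in Set.Icc (0 : ℝ) 1 ×ˢ Set.Icc (0 : ℝ) 1, (V !₂[q.1, q.2, (1 : ℝ)]) 2 * (V !₂[q.1, q.2, (1 : ℝ)]) 0 = 0) ∧ (∫ q in Set.Icc (0 : ℝ) 1 ×ˢ Set.Icc (0 : ℝ) 1, (V !₂[q.1, q.2, (1 : ℝ)]) 2 * (V !₂[q.1, q.2, (1 : ℝ)]) 1 =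 0)) :
    Summit.AnomalousDissipation.AnomalousDissipation.Theses.CoherentStates.SteadyZerothLaw := by
  obtain ⟨V, Q, C, F, hV, hF, hτ0, hτ1⟩ := hN
  obtain ⟨f, r, ub, π, C', hcap⟩ := stub_lerayCapping V Q C F hV hτ0 hτ1
  obtain ⟨ν, u, p, hν, hν0, hsol, hE, hε⟩ := hC V Q C F hV hF hτ0 hτ1 f r ub π C' hcap
  obtain ⟨hfs, hfd, hfm, -, -, hP, -⟩ := hcap
  exact stub_gateReduction f r hfs hfd hfm hP ν u p hν hν0 hsol hE hε

/-- **The kernel `K₀` implies the crux.**  If the existence of a normalised half-space hierarchy implies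
the steady zeroth law, then `DyadicRealisation` holds (`stub_profileNormalisations` turns the profile into
a normalised hierarchy).  Together with `steadyZerothLaw_of_testedRealisation`:
`C⁺ ⟹ K₀ ⟹ DyadicRealisation`, so `K₀` is the weakest statement through which line `Sketch` closes the
crux. [folklore] -/
theorem dyadicRealisation_of_normalisedKernel
    (hK : (∃ (V : EuclideanSpace ℝ (Fin 3) → EuclideanSpace ℝ (Fin 3)) (Q : EuclideanSpace ℝ (Fin 3) → ℝ) (C F : ℝ), (ContDiffOn ℝ ((⊤ : ℕ∞) : WithTop ℕ∞) V {X : EuclideanSpace ℝ (Fin 3) | 0 < X 2} ∧ ContDiffOn ℝ ((⊤ : ℕ∞) : WithTop ℕ∞) Q {X : EuclideanSpace ℝ (Fin 3) | 0 < X 2} ∧ (∀ X : EuclideanSpace ℝ (Fin 3), 0 < X 2 → ‖V X‖ ≤ C ∧ |Q X| ≤ C) ∧ (∀ X : EuclideanSpace ℝ (Fin 3), 0 < X 2 → ∑ i : Fin 3, (fderiv ℝ V X (EuclideanSpace.single i (1 : ℝ))) i = 0) ∧ (∀ X : EuclideanSpace ℝ (Fin 3), 0 < X 2 → (fderiv ℝ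 V X) (V X) + gradient Q X = 0) ∧ (∀ X : EuclideanSpace ℝ (Fin 3), 0 < X 2 → V ((2 : ℝ) • X) = V X ∧ Q ((2 : ℝ) • X) = Q X) ∧ (∀ X : EuclideanSpace ℝ (Fin 3), 1 ≤ X 2 → X 2 ≤ 2 → V (X + EuclideanSpace.single 0 (1 : ℝ)) = V X ∧ V (X + EuclideanSpace.single 1 (1 : ℝ)) = V X ∧ Q (X + EuclideanSpace.single 0 (1 : ℝ)) = Q X ∧ Q (X + EuclideanSpace.single 1 (1 : ℝ)) = Q X) ∧ (∫ q in Set.Icc (0 : ℝ) 1 ×ˢ Set.Icc (0 : ℝ) 1, (V !₂[q.1, q.2, (1 : ℝ)]) 2 = 0) ∧ F ≠ 0 ∧ (∫ q in Set.Icc (0 : ℝ) 1 ×ˢ Set.Icc (0 : ℝ) 1, (V !₂[q.1, q.2, (1 : ℝ)]) 2 * (‖V !₂[q.1, q.2, (1 : ℝ)]‖ ^ 2 / 2 + Q !₂[q.1, q.2, (1 : ℝ)]) = F)) ∧ F < 0 ∧ (∫ q in Set.Icc (0 : ℝ) 1 ×ˢ Set.Icc (0 : ℝ) 1, (V !₂[q.1,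 q.2, (1 : ℝ)]) 2 * (V !₂[q.1, q.2, (1 : ℝ)]) 0 = 0) ∧ (∫ q in Set.Icc (0 : ℝ) 1 ×ˢ Set.Icc (0 : ℝ) 1, (V !₂[q.1, q.2, (1 : ℝ)]) 2 * (V !₂[q.1, q.2, (1 : ℝ)]) 1 = 0)) →
      Summit.AnomalousDissipation.AnomalousDissipation.Theses.CoherentStates.SteadyZerothLaw) :
    Summit.AnomalousDissipation.AnomalousDissipation.Theses.DyadicWallCascade.DyadicRealisation :=
  fun hA => hK (stub_profileNormalisations hA)

/-- **Modulo crux #3 the crux is `HalfSpaceHierarchy → SteadyZerothLaw`.**  Given `ViscousContinuation`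
(`HalfSpaceHierarchy → ViscousWallProfile`, crux #3, needed by the route's assembly in any case),
`DyadicRealisation` is EQUIVALENT to `HalfSpaceHierarchy → SteadyZerothLaw`: forward, a hierarchy continues
to a profile (`h₃`) to which the crux applies; backward, a profile contains a hierarchy (its `V`-block is
crux #2's clause block verbatim).  As typed, the viscous profile `W` is logically idle in crux #4 for the
route. [folklore] -/
theorem dyadicRealisation_iff_of_viscousContinuation
    (h3 : Summit.AnomalousDissipation.AnomalousDissipation.Theses.DyadicWallCascade.ViscousContinuation) :
    Summit.AnomalousDissipation.AnomalousDissipation.Theses.DyadicWallCascade.DyadicRealisation ↔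
      (Summit.AnomalousDissipation.AnomalousDissipation.Theses.DyadicWallCascade.HalfSpaceHierarchy →
        Summit.AnomalousDissipation.AnomalousDissipation.Theses.CoherentStates.SteadyZerothLaw) := by
  constructor
  · intro hD h2
    exact hD (h3 h2)
  · rintro hK ⟨W, P, V, Q, C, F, C', hV, -⟩
    exact hK ⟨V, Q, C, F, hV⟩

/-- **Modulo crux #3 the crux is the kernel `K₀`.**  Given `ViscousContinuation`, `DyadicRealisation` is
equivalent to `K₀` = (a normalised half-space hierarchy exists) → `SteadyZerothLaw`: backward by
`dyadicRealisation_of_normalisedKernel`; forward, a normalised hierarchy is a hierarchy, which `h₃`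
continues to a profile. [folklore] -/
theorem dyadicRealisation_iff_normalisedKernel_of_viscousContinuation
    (h3 : Summit.AnomalousDissipation.AnomalousDissipation.Theses.DyadicWallCascade.ViscousContinuation) :
    Summit.AnomalousDissipation.AnomalousDissipation.Theses.DyadicWallCascade.DyadicRealisation ↔
      ((∃ (V : EuclideanSpace ℝ (Fin 3) → EuclideanSpace ℝ (Fin 3)) (Q : EuclideanSpace ℝ (Fin 3) → ℝ) (C F : ℝ), (ContDiffOn ℝ ((⊤ : ℕ∞) : WithTop ℕ∞) V {X : EuclideanSpace ℝ (Fin 3) | 0 < X 2} ∧ ContDiffOn ℝ ((⊤ : ℕ∞) : WithTop ℕ∞) Q {X : EuclideanSpace ℝ (Fin 3) | 0 < X 2} ∧ (∀ X : EuclideanSpace ℝ (Fin 3), 0 < X 2 → ‖V X‖ ≤ C ∧ |Q X| ≤ C) ∧ (∀ X : EuclideanSpace ℝ (Fin 3), 0 < X 2 → ∑ i : Fin 3, (fderiv ℝ V X (EuclideanSpace.single i (1 : ℝ))) i = 0) ∧ (∀ X : EuclideanSpace ℝ (Fin 3), 0 < X 2 → (fderiv ℝ V X) (V X) + gradient Q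 X = 0) ∧ (∀ X : EuclideanSpace ℝ (Fin 3), 0 < X 2 → V ((2 : ℝ) • X) = V X ∧ Q ((2 : ℝ) • X) = Q X) ∧ (∀ X : EuclideanSpace ℝ (Fin 3), 1 ≤ X 2 → X 2 ≤ 2 → V (X + EuclideanSpace.single 0 (1 : ℝ)) = V X ∧ V (X + EuclideanSpace.single 1 (1 : ℝ)) = V X ∧ Q (X + EuclideanSpace.single 0 (1 : ℝ)) = Q X ∧ Q (X + EuclideanSpace.single 1 (1 : ℝ)) = Q X) ∧ (∫ q in Set.Icc (0 : ℝ) 1 ×ˢ Set.Icc (0 : ℝ) 1, (V !₂[q.1, q.2, (1 : ℝ)]) 2 = 0) ∧ F ≠ 0 ∧ (∫ q in Set.Icc (0 : ℝ) 1 ×ˢ Set.Icc (0 : ℝ) 1, (V !₂[q.1, q.2, (1 : ℝ)]) 2 * (‖V !₂[q.1, q.2, (1 : ℝ)]‖ ^ 2 / 2 + Q !₂[q.1, q.2, (1 : ℝ)]) = F)) ∧ F < 0 ∧ (∫ q in Set.Icc (0 : ℝ) 1 ×ˢ Set.Icc (0 : ℝ) 1, (V !₂[q.1, q.2, (1 :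 ℝ)]) 2 * (V !₂[q.1, q.2, (1 : ℝ)]) 0 = 0) ∧ (∫ q in Set.Icc (0 : ℝ) 1 ×ˢ Set.Icc (0 : ℝ) 1, (V !₂[q.1, q.2, (1 : ℝ)]) 2 * (V !₂[q.1, q.2, (1 : ℝ)]) 1 = 0)) →
        Summit.AnomalousDissipation.AnomalousDissipation.Theses.CoherentStates.SteadyZerothLaw) := by
  constructor
  · rintro hD ⟨V, Q, C, F, hV, -, -, -⟩
    exact hD (h3 ⟨V, Q, C, F, hV⟩)
  · exact dyadicRealisation_of_normalisedKernel

/-- **Registered tools stub `stub_kernelTools`** (the conjunction of five lemmas of this file —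
`dyadicRealisation_of_steadyZerothLaw`, `dyadicRealisation_of_not_normalisedHierarchy`,
`dyadicRealisation_of_not_halfSpaceHierarchy`, `dyadicRealisation_of_normalisedKernel`,
`dyadicRealisation_iff_of_viscousContinuation` — so that the helper file proves a registered stub of the crux
item by name + signature; the two lemmas quoting `C⁺` / `K₀` a second time exceed the stub-signature length
limit and ride along unregistered). [folklore] -/
theorem stub_kernelTools : (Summit.AnomalousDissipation.AnomalousDissipation.Theses.CoherentStates.SteadyZerothLaw → Summit.AnomalousDissipation.AnomalousDissipation.Theses.DyadicWallCascade.DyadicRealisation) ∧ ((¬ ∃ (V : EuclideanSpace ℝ (Fin 3) → EuclideanSpace ℝ (Fin 3)) (Q : EuclideanSpace ℝ (Fin 3) → ℝ) (C F : ℝ), (ContDiffOn ℝ ((⊤ : ℕ∞) : WithTop ℕ∞) V {X : EuclideanSpace ℝ (Fin 3) | 0 < X 2} ∧ ContDiffOn ℝ ((⊤ : ℕ∞) : WithTop ℕ∞) Q {X : EuclideanSpace ℝ (Fin 3) | 0 < X 2} ∧ (∀ X : EuclideanSpace ℝ (Fin 3), 0 < X 2 → ‖V X‖ ≤ C ∧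 |Q X| ≤ C) ∧ (∀ X : EuclideanSpace ℝ (Fin 3), 0 < X 2 → ∑ i : Fin 3, (fderiv ℝ V X (EuclideanSpace.single i (1 : ℝ))) i = 0) ∧ (∀ X : EuclideanSpace ℝ (Fin 3), 0 < X 2 → (fderiv ℝ V X) (V X) + gradient Q X = 0) ∧ (∀ X : EuclideanSpace ℝ (Fin 3), 0 < X 2 → V ((2 : ℝ) • X) = V X ∧ Q ((2 : ℝ) • X) = Q X) ∧ (∀ X : EuclideanSpace ℝ (Fin 3), 1 ≤ X 2 → X 2 ≤ 2 → V (X + EuclideanSpace.single 0 (1 : ℝ)) = V X ∧ V (X + EuclideanSpace.single 1 (1 : ℝ)) = V X ∧ Q (X + EuclideanSpace.single 0 (1 : ℝ)) = Q X ∧ Q (X + EuclideanSpace.single 1 (1 : ℝ)) = Q X) ∧ (∫ q in Set.Icc (0 : ℝ) 1 ×ˢ Set.Icc (0 : ℝ) 1, (V !₂[q.1, q.2, (1 : ℝ)]) 2 = 0) ∧ F ≠ 0 ∧ (∫ q in Set.Icc (0 : ℝ) 1 ×ˢ Set.Icc (0 : ℝ) 1, (V !₂[q.1, q.2, (1 :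 ℝ)]) 2 * (‖V !₂[q.1, q.2, (1 : ℝ)]‖ ^ 2 / 2 + Q !₂[q.1, q.2, (1 : ℝ)]) = F)) ∧ F < 0 ∧ (∫ q in Set.Icc (0 : ℝ) 1 ×ˢ Set.Icc (0 : ℝ) 1, (V !₂[q.1, q.2, (1 : ℝ)]) 2 * (V !₂[q.1, q.2, (1 : ℝ)]) 0 = 0) ∧ (∫ q in Set.Icc (0 : ℝ) 1 ×ˢ Set.Icc (0 : ℝ) 1, (V !₂[q.1, q.2, (1 : ℝ)]) 2 * (V !₂[q.1, q.2, (1 : ℝ)]) 1 = 0)) → Summit.AnomalousDissipation.AnomalousDissipation.Theses.DyadicWallCascade.DyadicRealisation) ∧ ((¬ Summit.AnomalousDissipation.AnomalousDissipation.Theses.DyadicWallCascade.HalfSpaceHierarchy) → Summit.AnomalousDissipation.AnomalousDissipation.Theses.DyadicWallCascade.DyadicRealisation) ∧ (((∃ (V : EuclideanSpace ℝ (Fin 3) → EuclideanSpace ℝ (Fin 3)) (Q : EuclideanSpace ℝ (Fin 3) → ℝ) (C F : ℝ), (ContDiffOn ℝ ((⊤ : ℕ∞) : WithTop ℕ∞)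 V {X : EuclideanSpace ℝ (Fin 3) | 0 < X 2} ∧ ContDiffOn ℝ ((⊤ : ℕ∞) : WithTop ℕ∞) Q {X : EuclideanSpace ℝ (Fin 3) | 0 < X 2} ∧ (∀ X : EuclideanSpace ℝ (Fin 3), 0 < X 2 → ‖V X‖ ≤ C ∧ |Q X| ≤ C) ∧ (∀ X : EuclideanSpace ℝ (Fin 3), 0 < X 2 → ∑ i : Fin 3, (fderiv ℝ V X (EuclideanSpace.single i (1 : ℝ))) i = 0) ∧ (∀ X : EuclideanSpace ℝ (Fin 3), 0 < X 2 → (fderiv ℝ V X) (V X) + gradient Q X = 0) ∧ (∀ X : EuclideanSpace ℝ (Fin 3), 0 < X 2 → V ((2 : ℝ) • X) = V X ∧ Q ((2 : ℝ) • X) = Q X) ∧ (∀ X : EuclideanSpace ℝ (Fin 3), 1 ≤ X 2 → X 2 ≤ 2 → V (X + EuclideanSpace.single 0 (1 : ℝ)) = V X ∧ V (X + EuclideanSpace.single 1 (1 : ℝ)) = V X ∧ Q (X + EuclideanSpace.single 0 (1 : ℝ)) = Q X ∧ Q (X + EuclideanSpace.single 1 (1 : ℝ)) = Q X) ∧ (∫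 q in Set.Icc (0 : ℝ) 1 ×ˢ Set.Icc (0 : ℝ) 1, (V !₂[q.1, q.2, (1 : ℝ)]) 2 = 0) ∧ F ≠ 0 ∧ (∫ q in Set.Icc (0 : ℝ) 1 ×ˢ Set.Icc (0 : ℝ) 1, (V !₂[q.1, q.2, (1 : ℝ)]) 2 * (‖V !₂[q.1, q.2, (1 : ℝ)]‖ ^ 2 / 2 + Q !₂[q.1, q.2, (1 : ℝ)]) = F)) ∧ F < 0 ∧ (∫ q in Set.Icc (0 : ℝ) 1 ×ˢ Set.Icc (0 : ℝ) 1, (V !₂[q.1, q.2, (1 : ℝ)]) 2 * (V !₂[q.1, q.2, (1 : ℝ)]) 0 = 0) ∧ (∫ q in Set.Icc (0 : ℝ) 1 ×ˢ Set.Icc (0 : ℝ) 1, (V !₂[q.1, q.2, (1 : ℝ)]) 2 * (V !₂[q.1, q.2, (1 : ℝ)]) 1 = 0)) → Summit.AnomalousDissipation.AnomalousDissipation.Theses.CoherentStates.SteadyZerothLaw) → Summit.AnomalousDissipation.AnomalousDissipation.Theses.DyadicWallCascade.DyadicRealisation) ∧ (Summit.AnomalousDissipation.AnomalousDissipation.Theses.DyadicWallCascade.ViscousContinuation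 → (Summit.AnomalousDissipation.AnomalousDissipation.Theses.DyadicWallCascade.DyadicRealisation ↔ (Summit.AnomalousDissipation.AnomalousDissipation.Theses.DyadicWallCascade.HalfSpaceHierarchy → Summit.AnomalousDissipation.AnomalousDissipation.Theses.CoherentStates.SteadyZerothLaw))) :=
  ⟨dyadicRealisation_of_steadyZerothLaw, dyadicRealisation_of_not_normalisedHierarchy,
    dyadicRealisation_of_not_halfSpaceHierarchy, dyadicRealisation_of_normalisedKernel,
    dyadicRealisation_iff_of_viscousContinuation⟩

end Summit.AnomalousDissipation.AnomalousDissipation.Theorems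

end
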